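import Literature.Topology.FourManifolds.LatticeFormsAnisotropic
import Literature.Topology.FourManifolds.LatticeFormsVanDerBlij
import HarnessLib

/-!
# Odd indefinite unimodular lattices of rank `≤ 5` are `s I₊ ⊕ t I₋`, unconditionally

Trunk T-4MAN (lattice forms), companion of `LatticeFormsIndefiniteOdd.lean` and
`LatticeFormsAnisotropic.lean`. The former proves Serre's Theorem 4 and the type I case of
Theorem 6 (*A Course in Arithmetic*, Ch. V §2.2) FROM Theorem 3 ("an indefinite unimodular
lattice represents zero"), taken there as the named fact `exists_isotropic_of_isIndefinite`
(Hasse–Minkowski / Meyer input). The latter PROVES Theorem 3 in ranks `≤ 5`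
(`exists_isotropic_of_isIndefinite_of_finrank_le_five`, by reduction theory). Since the induction
proving Theorem 4 only ever descends in rank, the two combine into UNCONDITIONAL statements in
ranks `≤ 5` — exactly the range of second Betti numbers `b₂ ≤ 5` of the "small" simply connected
4-manifolds (`ℂℙ² # k ℂℙ²bar`, `k ≤ 4`; consumer:
`Literature/Barriers/SmoothPoincare4/SmallExoticaFrontierProofs.lean`, the form `⟨1⟩ ⊕ 2⟨-1⟩` of
`ℂℙ² # 2ℂℙ²bar`):

* `isDiagonalizable_of_isOdd_of_isIndefinite_of_finrank_le_five` — Theorem 4 in rank `≤ 5`;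
* `equivalent_of_isOdd_of_isIndefinite_of_finrank_le_five` — Theorem 6 (type I) in rank `≤ 5`:
  same rank and signature ⇒ isometric;
* `isOdd_of_not_eight_dvd_signature` — a unimodular lattice whose signature is not divisible by
  `8` is of type I (contrapositive of van der Blij's lemma, PROVED in the tree:
  `eight_dvd_signature_of_isEven_holds`);
* `equivalent_of_finrank_le_five_of_not_eight_dvd_signature` — two symmetric unimodular lattices
  of the same rank `r ≤ 5` and the same signature `σ` with `|σ| < r` and `8 ∤ σ` are isometric
  (e.g. `r = 3`, `σ = -1`: both are `⟨1⟩ ⊕ ⟨-1⟩ ⊕ ⟨-1⟩`).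

The proof of the first is the induction of `isDiagonalizable_of_isOdd_of_isIndefinite_aux`
(Serre, Ch. V §3.3) verbatim, with Theorem 3 supplied by the rank-`≤ 5` theorem at every step.
`ℤ`-lattices carry the canonical structure `AddCommGroup.toIntModule` (only `[AddCommGroup M]` is
assumed) and the declarations extend the Mathlib namespace `LinearMap.BilinForm` by dot-notation
style lemmas, deliberately, exactly as the sibling lattice files do.

## Sources

* J.-P. Serre, *A Course in Arithmetic* (GTM 7, Springer 1973), Ch. V §2.2 Thms 3, 4, 6 and
  §3.3 (proof of Thm 4); §2.1 Thm 2 Cor. 1 (`σ ≡ 0 mod 8` for type II). [Serre1973]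
* J. Milnor, D. Husemoller, *Symmetric bilinear forms* (Springer 1973), Ch. II §4 Thm 4.3,
  §5 (5.1). [MilnorHusemoller1973]
-/

open Module
open LinearMap (BilinForm)

universe u v

namespace LinearMap.BilinForm

variable {M : Type u} [AddCommGroup M]

/-- **Serre's Theorem 4 in rank `≤ 5`, unconditional.** A symmetric unimodular lattice of type I
(odd) which is indefinite and has rank `≤ 5` admits an orthogonal `ℤ`-basis (hence is
`≅ s I₊ ⊕ t I₋`). The induction of Serre, *A Course in Arithmetic*, Ch. V §3.3 (as in
`isDiagonalizable_of_isOdd_of_isIndefinite_aux`), with Theorem 3 supplied at each step by the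
proved rank-`≤ 5` case `exists_isotropic_of_isIndefinite_of_finrank_le_five`.
[cite: Serre1973, Ch. V §2.2 Thm 4, §3.3] -/
theorem isDiagonalizable_of_isOdd_of_isIndefinite_of_finrank_le_five_aux (n : ℕ) (hn5 : n ≤ 5) :
    ∀ (M : Type u) [AddCommGroup M] [Module.Finite ℤ M] [Module.Free ℤ M]
      (B : BilinForm ℤ M), finrank ℤ M ≤ n → B.IsSymm → B.IsUnimodular → B.IsOdd →
      B.IsIndefinite → B.IsDiagonalizable := by
  induction n with
  | zero =>
    intro M _ _ _ B hn _ _ _ _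
    exact isDiagonalizable_of_finrank_le_one B (by omega)
  | succ n ih =>
    intro M _ _ _ B hn hB hu hodd hind
    haveI : B.IsPerfPair := hu
    -- Theorem 3 (rank ≤ 5, proved) and Lemma 3: an isotropic `x` and `y` with `x.y = 1`
    obtain ⟨x₀, hx₀0, hx₀⟩ :=
      exists_isotropic_of_isIndefinite_of_finrank_le_five hB hu hind (by omega)
    obtain ⟨x, y, hx, hxy⟩ := exists_isotropic_dual_pair hx₀0 hx₀
    -- Lemma 4: `u.u = 1`, `w.w = -1`, `u.w = 0`
    obtain ⟨u, w, huu, hww, huw⟩ := exists_orthogonal_unit_pair_of_isOdd hB hodd hx hxy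
    have hwu : B w u = 0 := by rw [hB.eq w u, huw]
    have hu0 : u ≠ 0 := fun h0 => by simp [h0] at huu
    have hw0 : w ≠ 0 := fun h0 => by simp [h0] at hww
    -- the two complements
    set U : Submodule ℤ M := B.orthogonal (ℤ ∙ u) with hUdef
    set W : Submodule ℤ M := B.orthogonal (ℤ ∙ w) with hWdef
    have hwU : w ∈ U := (mem_orthogonal_span_singleton_iff B).mpr huw
    have huW : u ∈ W := (mem_orthogonal_span_singleton_iff B).mpr hwu
    have hU1 : finrank ℤ M = finrank ℤ U + 1 :=
      finrank_eq_finrank_orthogonal_singleton_add_one hB u huu (by norm_num)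
    have hW1 : finrank ℤ M = finrank ℤ W + 1 :=
      finrank_eq_finrank_orthogonal_singleton_add_one hB w hww (by norm_num)
    have hUu : (B.restrict U).IsUnimodular :=
      isUnimodular_restrict_orthogonal_singleton hu hB u huu (by norm_num)
    have hWu : (B.restrict W).IsUnimodular :=
      isUnimodular_restrict_orthogonal_singleton hu hB w hww (by norm_num)
    have hUodd : (B.restrict U).IsOdd :=
      (isOdd_iff _).mpr ⟨⟨w, hwU⟩, by change Odd (B w w); rw [hww]; decide⟩
    have hWodd : (B.restrict W).IsOdd :=
      (isOdd_iff _).mpr ⟨⟨u, huW⟩, by change Odd (B u u); rw [huu]; decide⟩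
    by_cases hUind : (B.restrict U).IsIndefinite
    · -- `E ≅ I₊ ⊕ u^⊥` with `u^⊥` odd indefinite of smaller rank
      exact isDiagonalizable_of_restrict_orthogonal_singleton hB u huu (by norm_num)
        (ih (by omega) U (B.restrict U) (by omega) (hB.restrict U) hUu hUodd hUind)
    · -- `u^⊥` is definite, hence negative definite (it contains `w`); use `E ≅ I₋ ⊕ w^⊥`
      have hUneg : (B.restrict U).NegDef := by
        rcases not_not.mp hUind with hpos | hneg
        · have h := (posDef_iff _).mp hpos ⟨w, hwU⟩ (fun h0 => hw0 (congrArg Subtype.val h0))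
          change 0 < B w w at h
          rw [hww] at h
          exact absurd h (by decide)
        · exact hneg
      refine isDiagonalizable_of_restrict_orthogonal_singleton hB w hww (by norm_num) ?_
      by_cases hW2 : finrank ℤ W ≤ 1
      · exact isDiagonalizable_of_finrank_le_one _ hW2
      · -- `rank ≥ 3`: `u^⊥ ∩ w^⊥ ≠ 0` gives a vector of negative square in `w^⊥`
        have hz : ∃ z, z ∈ U ∧ z ∈ W ∧ z ≠ 0 := by
          by_contra hcon
          push Not at hcon
          have hdis : Disjoint U W := by
            rw [Submodule.disjoint_def]
            exact fun z hzU hzW => hcon z hzU hzW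
          have := finrank_add_finrank_le_of_disjoint_of_isDomain hdis
          omega
        obtain ⟨z, hzU, hzW, hz0⟩ := hz
        have hzneg : B z z < 0 := by
          have := (negDef_iff _).mp hUneg ⟨z, hzU⟩ (fun h0 => hz0 (congrArg Subtype.val h0))
          simpa using this
        have hWind : (B.restrict W).IsIndefinite :=
          isIndefinite_of_apply_self_neg_of_pos (x := ⟨z, hzW⟩) (y := ⟨u, huW⟩)
            (by change B z z < 0; exact hzneg) (by change 0 < B u u; rw [huu]; decide)
        exact ih (by omega) W (B.restrict W) (by omega) (hB.restrict W) hWu hWodd hWind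

/-- **Serre's Theorem 4 in rank `≤ 5`** (unconditional): a symmetric unimodular lattice of type I
(odd) which is indefinite and of rank `≤ 5` admits an orthogonal `ℤ`-basis; its squares are then
`±1` (`apply_basis_self_eq_one_or_of_isOrthoᵢ`), i.e. "`E` is isomorphic to `s I₊ ⊕ t I₋`"
(Serre, *A Course in Arithmetic*, Ch. V §2.2 Thm 4; proof §3.3; Theorem 3 is needed only in
ranks `≤ 5`, where it is `exists_isotropic_of_isIndefinite_of_finrank_le_five`).
[cite: Serre1973, Ch. V §2.2 Thm 4] -/
theorem isDiagonalizable_of_isOdd_of_isIndefinite_of_finrank_le_five [Module.Finite ℤ M]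
    [Module.Free ℤ M] {B : BilinForm ℤ M} (hB : B.IsSymm) (hu : B.IsUnimodular) (hodd : B.IsOdd)
    (hind : B.IsIndefinite) (h5 : finrank ℤ M ≤ 5) : B.IsDiagonalizable :=
  isDiagonalizable_of_isOdd_of_isIndefinite_of_finrank_le_five_aux 5 le_rfl M B h5 hB hu hodd hind

/-- **Theorem 6, type I, rank `≤ 5`** (unconditional). Two symmetric unimodular odd indefinite
lattices of the same rank `≤ 5` and the same signature are isometric: both are `s I₊ ⊕ t I₋` with
`s + t = r`, `s - t = σ` (Serre, *A Course in Arithmetic*, Ch. V §2.2, Thm 4 and Thm 6 "since the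
same is true for type I (cf. theorem 4)"; Milnor–Husemoller II Thm 4.3). The two lattices may live
in different universes. [cite: Serre1973, Ch. V §2.2 Thms 4, 6] -/
theorem equivalent_of_isOdd_of_isIndefinite_of_finrank_le_five
    {M : Type u} {M' : Type v} [AddCommGroup M] [Module.Finite ℤ M] [Module.Free ℤ M]
    [AddCommGroup M'] [Module.Finite ℤ M'] [Module.Free ℤ M']
    {B : BilinForm ℤ M} {B' : BilinForm ℤ M'}
    (hB : B.IsSymm) (hu : B.IsUnimodular) (hodd : B.IsOdd) (hind : B.IsIndefinite)
    (hB' : B'.IsSymm) (hu' : B'.IsUnimodular) (hodd' : B'.IsOdd) (hind' : B'.IsIndefinite)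
    (h5 : finrank ℤ M ≤ 5) (hrank : finrank ℤ M = finrank ℤ M')
    (hsig : B.signature = B'.signature) : B.Equivalent B' := by
  obtain ⟨ι, b, hb⟩ := isDiagonalizable_of_isOdd_of_isIndefinite_of_finrank_le_five hB hu hodd hind h5
  obtain ⟨ι', b', hb'⟩ :=
    isDiagonalizable_of_isOdd_of_isIndefinite_of_finrank_le_five hB' hu' hodd' hind' (hrank ▸ h5)
  haveI : Finite ι := Module.Finite.finite_basis b
  haveI : Finite ι' := Module.Finite.finite_basis b'
  haveI : Fintype ι := Fintype.ofFinite ι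
  haveI : Fintype ι' := Fintype.ofFinite ι'
  exact equivalent_of_isOrthoᵢ_of_sq_eq_one_or hb hb'
    (apply_basis_self_eq_one_or_of_isOrthoᵢ hu hb) (apply_basis_self_eq_one_or_of_isOrthoᵢ hu' hb')
    hrank hsig

/-- **Type I from the signature.** A symmetric unimodular lattice whose signature is not divisible
by `8` is odd (type I): contrapositive of van der Blij's lemma "the signature of an even
unimodular lattice is `≡ 0 (mod 8)`" (Serre, *A Course in Arithmetic*, Ch. V §2.1 Thm 2, Cor. 1;
Milnor–Husemoller II (5.1)), which is PROVED in the tree (`eight_dvd_signature_of_isEven_holds`).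
E.g. `σ = ±1`: the forms of `ℂℙ² # k ℂℙ²bar`-like manifolds are odd.
[cite: Serre1973, Ch. V §2.1 Thm 2 Cor. 1] -/
theorem isOdd_of_not_eight_dvd_signature [Module.Finite ℤ M] [Module.Free ℤ M] {B : BilinForm ℤ M}
    (hB : B.IsSymm) (hu : B.IsUnimodular) (h8 : ¬ (8 : ℤ) ∣ B.signature) : B.IsOdd :=
  fun he => h8 (eight_dvd_signature_of_isEven_holds B hB hu he)

/-- **Small odd lattices are classified by rank and signature** (unconditional corollary). Two
symmetric unimodular lattices of the same rank `r ≤ 5` and the same signature `σ`, with `|σ| < r`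
(indefinite, `isIndefinite_iff_abs_signature_lt_finrank`) and `8 ∤ σ` (type I,
`isOdd_of_not_eight_dvd_signature`), are isometric — for `r = 3`, `σ = -1` both are
`⟨1⟩ ⊕ ⟨-1⟩ ⊕ ⟨-1⟩`, the intersection form of `ℂℙ² # 2ℂℙ²bar` (Serre, *A Course in Arithmetic*,
Ch. V §2.2 Thm 6 with Thm 4 and §2.1 Thm 2 Cor. 1). [cite: Serre1973, Ch. V §2.2 Thm 6] -/
theorem equivalent_of_finrank_le_five_of_not_eight_dvd_signature
    {M : Type u} {M' : Type v} [AddCommGroup M] [Module.Finite ℤ M] [Module.Free ℤ M]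
    [AddCommGroup M'] [Module.Finite ℤ M'] [Module.Free ℤ M']
    {B : BilinForm ℤ M} {B' : BilinForm ℤ M'}
    (hB : B.IsSymm) (hu : B.IsUnimodular) (hB' : B'.IsSymm) (hu' : B'.IsUnimodular)
    (h5 : finrank ℤ M ≤ 5) (hrank : finrank ℤ M = finrank ℤ M')
    (hsig : B.signature = B'.signature) (hlt : |B.signature| < (finrank ℤ M : ℤ))
    (h8 : ¬ (8 : ℤ) ∣ B.signature) : B.Equivalent B' := by
  have hind : B.IsIndefinite :=
    (isIndefinite_iff_abs_signature_lt_finrank hB hu.separatingLeft).mpr hlt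
  have hind' : B'.IsIndefinite :=
    (isIndefinite_iff_abs_signature_lt_finrank hB' hu'.separatingLeft).mpr
      (by rw [← hsig, ← hrank]; exact hlt)
  exact equivalent_of_isOdd_of_isIndefinite_of_finrank_le_five hB hu
    (isOdd_of_not_eight_dvd_signature hB hu h8) hind hB' hu'
    (isOdd_of_not_eight_dvd_signature hB' hu' (hsig ▸ h8)) hind' h5 hrank hsig

/-- **Small odd lattices are classified by rank and signature — arbitrary `Module ℤ` instances.**
The statement of `equivalent_of_finrank_le_five_of_not_eight_dvd_signature` for forms `Q`, `Q'`
on `ℤ`-modules `V`, `V'` whose `Module ℤ` structures are arbitrary instances (e.g. the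
`ModuleCat` carrier structure of `H²(M; ℤ)/T`, on which intersection forms live); they coincide
with the canonical `AddCommGroup.toIntModule` by `Subsingleton (Module ℤ V)` (pattern of
`equivalent_of_isIndefinite_of_exists_isotropic`). Serre, *A Course in Arithmetic*, Ch. V §2.2
Thm 6 with Thm 4 and §2.1 Thm 2 Cor. 1, ranks `≤ 5`. [cite: Serre1973, Ch. V §2.2 Thm 6] -/
theorem equivalent_of_finrank_le_five_of_not_eight_dvd_signature'
    {V : Type u} {V' : Type v} [AddCommGroup V] [Module ℤ V] [AddCommGroup V'] [Module ℤ V']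
    [Module.Finite ℤ V] [Module.Free ℤ V] [Module.Finite ℤ V'] [Module.Free ℤ V']
    {Q : LinearMap.BilinForm ℤ V} {Q' : LinearMap.BilinForm ℤ V'}
    (hQ : Q.IsSymm) (hu : Q.IsUnimodular) (hQ' : Q'.IsSymm) (hu' : Q'.IsUnimodular)
    (h5 : finrank ℤ V ≤ 5) (hrank : finrank ℤ V = finrank ℤ V')
    (hsig : Q.signature = Q'.signature) (hlt : |Q.signature| < (finrank ℤ V : ℤ))
    (h8 : ¬ (8 : ℤ) ∣ Q.signature) : Q.Equivalent Q' := by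
  have hV := Subsingleton.elim ‹Module ℤ V› (AddCommGroup.toIntModule V)
  have hV' := Subsingleton.elim ‹Module ℤ V'› (AddCommGroup.toIntModule V')
  subst hV hV'
  exact equivalent_of_finrank_le_five_of_not_eight_dvd_signature hQ hu hQ' hu' h5 hrank hsig hlt h8

end LinearMap.BilinForm
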